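import Summits.Schanuel.Schanuel.Theorems.RootDecomp1PillayTupleExpE

/-!
# RootDecomp1 — SATURATION of Pillay's tuple at `u = e^e` rel. S; the saturated shared-witness programme is inconsistent with
the summit (lens-1 round 11 rev b, part F; `--supports stmt-Schanuel-30352`)

For `u = e^e`, `z = (u, v(u), u²)`: rel. S every `w` with `w, e^w` algebraic over `F_z = ℚ(z, e^z)` lies in `span_ℚ z`
(`saturated_pillayTuple_expE_of_schanuel`: Schanuel at `(w, e, v, u², u, 1)` would give `6 ≤ 5`, so `w ∈ span_ℚ(e, v, u², u, 1)`;
the `e`- and `1`-coefficients vanish because `e ∉ F^alg`).  Hence `schanuel_forces_saturated_nonmodular_entanglement` (an explicit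
SATURATED, entangled, witness-free ℚ-l.i. triple in `ecl ∅`, rel. S) and `schanuel_imp_not_saturatedWitnessProgramme`: the lemma
«binders of stmt-Schanuel-30352 (verbatim) ⟹ modular witness» is refuted rel. S — correction of part D's scope requested by
decomp-schanuel-crit-1 (2026-08-30T12:30:23Z), now at the level of the residual itself.
-/

set_option linter.dupNamespace false

noncomputable section

namespace Summit.Schanuel.Schanuel.Theorems.RootDecomp1ModularLayer

open Complex IntermediateField
open scoped BigOperators Cardinal
open Summit.Schanuel.Schanuel.Theorems.RootDecomp1EAnchor (isAlgebraic_of_trdeg_sandwich trdeg_adjoin_le_of_isAlgebraic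
  trdeg_adjoin_union_le trdeg_adjoin_le_nat exists_nat_eq_of_le_natCast isAlgebraic_of_mem_adjoin isAlgebraic_of_le
  isAlgebraic_of_isAlgebraic_adjoin trdeg_adjoin_sum_le_union one_le_trdeg_adjoin_singleton isAlgebraic_mul)
open Summit.Schanuel.Schanuel.Theorems.RootDecomp1ArgumentCells (le_trdeg_of_algebraicIndependent_mem)
open Summit.Schanuel.Schanuel.Theorems.RootDecomp1AtomRigidity (mem_adjoin_range_of_mem_span_int
  exp_mem_adjoin_exp_of_mem_span_int)
open Summit.Schanuel.Schanuel.Theorems.RootDecomp1SharedDegree (trdeg_union_add_one_le_of_shared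
  entangled_of_shared_transcendental lt_of_add_one_le_of_le_nat)
open Literature.NumberTheory.Transcendental (SchanuelRank transcendental_exp transcendental_exp_holds
  exists_nsmul_mem_span_int isAlgebraic_adjoin_over_algebraAdjoin transcendental_rat_cexp_one)
open Literature.NumberTheory.Transcendental.OneMotiveToric (trdeg_mono)
open Literature.Barriers.Schanuel (algebraicIndependent_of_le_trdeg_adjoin trdeg_adjoin_union_eq_of_isAlgebraic)

/-- (private copy; the public form is a print-twin of a landed declaration — gate dedup, as in parts B/C) A field
generated by an `m`-tuple has `trdeg ≤ m`. -/
private theorem trdeg_adjoin_range_le {m : ℕ} (x : Fin m → ℂ) : Algebra.trdeg ℚ ↥(adjoin ℚ (Set.range x)) ≤ (m : Cardinal) :=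
  trdeg_adjoin_le_nat _ (by simpa using Cardinal.mk_range_le (f := x))

/-! ### Saturation of Pillay's tuple at `u = e^e` rel. Schanuel -/

/-- **SATURATION rel. S.**  For `u = e^e` and `z = pillayTuple u`: every `w` with `w` and `e^w` algebraic over
`F_z = ℚ(z, e^z)` lies in `span_ℚ z`.  Proof: Schanuel at `(w, e, v, u², u, 1)` would give `6 ≤ trdeg ≤ 5`, so
`w ∈ span_ℚ(e, v, u², u, 1)`; after integer rescaling `N w = c₀ e + X + c₄` with `X ∈ span_ℤ z`; `c₀ ≠ 0` makes `e`
algebraic over `F`, `c₀ = 0 ≠ c₄` makes `e^{c₄}` hence `e` algebraic over `F` — both excluded — so `N w = X`. -/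
theorem saturated_pillayTuple_expE_of_schanuel (hS : Literature.Periods.SchanuelConjecture) :
    ∀ w : ℂ, IsAlgebraic ↥(adjoin ℚ (Set.range (pillayTuple (cexp (cexp 1))) ∪
        Set.range (cexp ∘ pillayTuple (cexp (cexp 1))))) w →
      IsAlgebraic ↥(adjoin ℚ (Set.range (pillayTuple (cexp (cexp 1))) ∪
        Set.range (cexp ∘ pillayTuple (cexp (cexp 1))))) (cexp w) →
      w ∈ Submodule.span ℚ (Set.range (pillayTuple (cexp (cexp 1)))) := by
  intro w hw hew
  set e : ℂ := cexp 1 with he_def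
  set u : ℂ := cexp (cexp 1) with hu_def
  set z := pillayTuple u with hz_def
  set g4 : Fin 4 → ℂ := ![u, pillayV u, cexp u, cexp (pillayV u)] with hg4
  set F4 : IntermediateField ℚ ℂ := adjoin ℚ (Set.range g4) with hF4
  have huF : u ∈ F4 := subset_adjoin ℚ _ ⟨0, by simp [hg4]⟩
  have hvF : pillayV u ∈ F4 := subset_adjoin ℚ _ ⟨1, by simp [hg4]⟩
  have heuF : cexp u ∈ F4 := subset_adjoin ℚ _ ⟨2, by simp [hg4]⟩
  have hevF : cexp (pillayV u) ∈ F4 := subset_adjoin ℚ _ ⟨3, by simp [hg4]⟩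
  have hzF : ∀ i, z i ∈ F4 := by
    intro i; fin_cases i
    · simpa [hz_def] using huF
    · simpa [hz_def] using hvF
    · simpa [hz_def] using pow_mem huF 2
  have hezF : ∀ i, cexp (z i) ∈ F4 := by
    intro i; fin_cases i
    · simpa [hz_def] using heuF
    · simpa [hz_def] using hevF
    · simpa [hz_def, exp_sq_eq] using add_mem (mul_mem huF heuF) hvF
  have hFz_le : adjoin ℚ (Set.range z ∪ Set.range (cexp ∘ z)) ≤ F4 :=
    adjoin_le_iff.mpr (by rintro _ (⟨i, rfl⟩ | ⟨i, rfl⟩); exacts [hzF i, hezF i])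
  have hw4 : IsAlgebraic ↥F4 w := isAlgebraic_of_le hFz_le hw
  have hew4 : IsAlgebraic ↥F4 (cexp w) := isAlgebraic_of_le hFz_le hew
  have heF4 : ¬ IsAlgebraic ↥F4 e := e_not_isAlgebraic_over_F_of_schanuel hS
  have hT := linearIndependent_T_of_schanuel hS
  -- (1) `w ∈ span_ℚ (e, v, u², u, 1)`
  have hwT : w ∈ Submodule.span ℚ (Set.range ![e, pillayV u, u ^ 2, u, (1 : ℂ)]) := by
    by_contra hnot
    have hli6 : LinearIndependent ℚ ![w, e, pillayV u, u ^ 2, u, (1 : ℂ)] := linearIndependent_finCons.mpr ⟨hT, hnot⟩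
    have h6 := hS 6 _ hli6
    set L : IntermediateField ℚ ℂ := adjoin ℚ (insert (cexp w) (insert w (insert e (Set.range g4)))) with hL
    have hF4L : F4 ≤ L := adjoin.mono ℚ _ _ (fun x hx =>
      Set.mem_insert_of_mem _ (Set.mem_insert_of_mem _ (Set.mem_insert_of_mem _ hx)))
    have hewL : cexp w ∈ L := subset_adjoin ℚ _ (Set.mem_insert _ _)
    have hwL : w ∈ L := subset_adjoin ℚ _ (Set.mem_insert_of_mem _ (Set.mem_insert _ _))
    have heL : e ∈ L := subset_adjoin ℚ _ (Set.mem_insert_of_mem _ (Set.mem_insert_of_mem _ (Set.mem_insert _ _)))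
    have hle : adjoin ℚ (Set.range ![w, e, pillayV u, u ^ 2, u, (1 : ℂ)] ∪
        Set.range (cexp ∘ ![w, e, pillayV u, u ^ 2, u, (1 : ℂ)])) ≤ L := by
      refine adjoin_le_iff.mpr ?_
      rintro _ (⟨i, rfl⟩ | ⟨i, rfl⟩)
      · fin_cases i
        · simpa using hwL
        · simpa using heL
        · simpa using hF4L hvF
        · simpa using pow_mem (hF4L huF) 2
        · simpa using hF4L huF
        · simp
      · fin_cases i
        · simpa using hewL
        · simpa [hu_def] using hF4L huF
        · simpa using hF4L hevF
        · simpa [exp_sq_eq] using add_mem (mul_mem (hF4L huF) (hF4L heuF)) (hF4L hvF)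
        · simpa using hF4L heuF
        · simpa [he_def] using heL
    have h5 : Algebra.trdeg ℚ ↥L ≤ ((5 : ℕ) : Cardinal) := by
      have hA : IsAlgebraic ↥(adjoin ℚ (insert w (insert e (Set.range g4)))) (cexp w) :=
        isAlgebraic_of_le (adjoin.mono ℚ _ _ (fun x hx => Set.mem_insert_of_mem _ (Set.mem_insert_of_mem _ hx))) hew4
      have hB : IsAlgebraic ↥(adjoin ℚ (insert e (Set.range g4))) w :=
        isAlgebraic_of_le (adjoin.mono ℚ _ _ (fun x hx => Set.mem_insert_of_mem _ hx)) hw4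
      calc Algebra.trdeg ℚ ↥L = Algebra.trdeg ℚ ↥(adjoin ℚ (insert w (insert e (Set.range g4)))) :=
            trdeg_adjoin_insert_eq_of_isAlgebraic hA
        _ = Algebra.trdeg ℚ ↥(adjoin ℚ (insert e (Set.range g4))) := trdeg_adjoin_insert_eq_of_isAlgebraic hB
        _ ≤ Algebra.trdeg ℚ ↥(adjoin ℚ (Set.range g4)) + 1 :=
            Literature.NumberTheory.Transcendental.trdeg_adjoin_insert_le _ _
        _ ≤ ((4 : ℕ) : Cardinal) + 1 := add_le_add (trdeg_adjoin_range_le g4) le_rfl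
        _ = ((5 : ℕ) : Cardinal) := by norm_cast
    have : ((6 : ℕ) : Cardinal) ≤ ((5 : ℕ) : Cardinal) := h6.trans ((trdeg_mono hle).trans h5)
    have : (6 : ℕ) ≤ 5 := by exact_mod_cast this
    omega
  -- (2) integer rescaling
  obtain ⟨N, hN, hNw⟩ := exists_nsmul_mem_span_int _ hwT
  obtain ⟨c, hc⟩ := (Submodule.mem_span_range_iff_exists_fun ℤ).mp hNw
  simp only [Fin.sum_univ_five, Matrix.cons_val_zero, Matrix.cons_val_one, Matrix.cons_val, zsmul_eq_mul,
    mul_one] at hc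
  have hNw_eq : ((N : ℂ)) * w = (c 0 : ℂ) * e + ((c 1 : ℂ) * pillayV u + (c 2 : ℂ) * u ^ 2 + (c 3 : ℂ) * u) + (c 4 : ℂ) := by
    have : ((N : ℚ) • w : ℂ) = (N : ℂ) * w := by rw [Rat.smul_def]; push_cast; rfl
    rw [← this, ← hc]; ring
  set X : ℂ := (c 1 : ℂ) * pillayV u + (c 2 : ℂ) * u ^ 2 + (c 3 : ℂ) * u with hX
  have hz0 : z 0 = u := by simp [hz_def]
  have hz1 : z 1 = pillayV u := by simp [hz_def]
  have hz2 : z 2 = u ^ 2 := by simp [hz_def]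
  have hXz : X ∈ Submodule.span ℤ (Set.range z) := by
    refine add_mem (add_mem ?_ ?_) ?_
    · rw [← hz1, ← zsmul_eq_mul]; exact Submodule.smul_mem _ _ (Submodule.subset_span ⟨1, rfl⟩)
    · rw [← hz2, ← zsmul_eq_mul]; exact Submodule.smul_mem _ _ (Submodule.subset_span ⟨2, rfl⟩)
    · rw [← hz0, ← zsmul_eq_mul]; exact Submodule.smul_mem _ _ (Submodule.subset_span ⟨0, rfl⟩)
  have hXF : X ∈ F4 :=
    (adjoin_le_iff.mpr (by rintro _ ⟨i, rfl⟩; exact hzF i)) (mem_adjoin_range_of_mem_span_int z hXz)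
  have hNF : (N : ℂ) ∈ F4 := _root_.natCast_mem F4 N
  by_cases hc0 : c 0 = 0
  · by_cases hc4 : c 4 = 0
    · -- `N w = X ∈ span_ℤ z`
      have hNwX : (N : ℂ) * w = X := by rw [hNw_eq, hc0, hc4]; push_cast; ring
      have hXq : X ∈ Submodule.span ℚ (Set.range z) := Submodule.span_le_restrictScalars ℤ ℚ _ hXz
      have hN0 : (N : ℂ) ≠ 0 := by exact_mod_cast hN
      have hw_eq : w = ((N : ℚ)⁻¹ : ℚ) • X := by
        rw [← hNwX, Rat.smul_def]; push_cast; field_simp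
      rw [hw_eq]; exact Submodule.smul_mem _ _ hXq
    · -- `c₀ = 0 ≠ c₄`: `e^{c₄} = e^{Nw} / e^{X}` is algebraic over `F`, hence so is `e`
      exfalso
      apply heF4
      have hexpX : cexp X ∈ F4 :=
        (adjoin_le_iff.mpr (by rintro _ ⟨i, rfl⟩; exact hezF i)) (exp_mem_adjoin_exp_of_mem_span_int z hXz)
      have hexpX0 : cexp X ≠ 0 := Complex.exp_ne_zero X
      have hEq : cexp ((c 4 : ℤ) : ℂ) = cexp w ^ N * (cexp X)⁻¹ := by
        have h1 : ((c 4 : ℤ) : ℂ) = (N : ℂ) * w - X := by rw [hNw_eq, hc0]; push_cast; ring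
        rw [h1, Complex.exp_sub, Complex.exp_nat_mul, div_eq_mul_inv]
      have halg : IsAlgebraic ↥F4 (cexp ((c 4 : ℤ) : ℂ)) := by
        rw [hEq]; exact isAlgebraic_mul (hew4.pow N) (isAlgebraic_of_mem_adjoin (inv_mem hexpX))
      have hzpow : cexp ((c 4 : ℤ) : ℂ) = e ^ (c 4 : ℤ) := by
        rw [he_def, ← Complex.exp_int_mul 1 (c 4), mul_one]
      rw [hzpow] at halg
      have hpos : 0 < (c 4).natAbs := Int.natAbs_pos.mpr hc4
      rcases Int.natAbs_eq (c 4) with h | h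
      · rw [h, zpow_natCast] at halg
        exact IsAlgebraic.of_pow hpos halg
      · rw [h, zpow_neg, zpow_natCast, IsAlgebraic.inv_iff] at halg
        exact IsAlgebraic.of_pow hpos halg
  · -- `c₀ ≠ 0`: `e = (N w − X − c₄) / c₀` is algebraic over `F`
    exfalso
    apply heF4
    have hc0' : (c 0 : ℂ) ≠ 0 := by exact_mod_cast hc0
    have he_eq : e = ((N : ℂ) * w - X - (c 4 : ℂ)) * ((c 0 : ℂ))⁻¹ := by
      rw [hNw_eq]; field_simp; ring
    rw [he_eq]
    refine isAlgebraic_mul (isAlgebraic_sub (isAlgebraic_sub (isAlgebraic_mul (isAlgebraic_of_mem_adjoin hNF) hw4)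
      (isAlgebraic_of_mem_adjoin hXF)) (isAlgebraic_of_mem_adjoin (_root_.intCast_mem F4 (c 4)))) ?_
    exact isAlgebraic_of_mem_adjoin (inv_mem (_root_.intCast_mem F4 (c 0)))

/-! ### The residual-level NO-GO -/

/- (port) the node's `SaturatedWitnessProgramme` (the binders of stmt-Schanuel-30352 VERBATIM ⟹ modular witness) is
   spelled out inside `schanuel_imp_not_saturatedWitnessProgramme`. -/

/-- **Cᵉ[μ = 0] IS INHABITED REL. S; THE SATURATED SHARED-WITNESS PROGRAMME IS INCONSISTENT WITH THE SUMMIT.**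
Under Schanuel, Pillay's tuple at `u = e^e` satisfies EVERY hypothesis of the residual `EntangledSaturatedEssentialSchanuel`
(stmt-Schanuel-30352) — `n = 3`, ℚ-l.i., `⊂ ecl ∅`, span-minimal, SATURATED, affinely / quadratically / rationally
non-degenerate, ENTANGLED — and has NO modular witness; so the lemma «binders of 30352 ⟹ modular witness» (binders copied
verbatim from the item) is refuted rel. S.  (decomp-schanuel-crit-1 2026-08-30T12:30:23Z: the tuple at `u = e` of part D is NOT
saturated, `w = 1`; the saturated layer is reached here at `u = e^e`.) -/
theorem schanuel_imp_not_saturatedWitnessProgramme (hS : Literature.Periods.SchanuelConjecture) :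
    ¬ (∀ (n : ℕ), 3 ≤ n → ∀ (z : Fin n → ℂ), LinearIndependent ℚ z →
    (∀ i, z i ∈ Literature.NumberTheory.Transcendental.ecl (∅ : Set ℂ)) →
    (∀ (m : ℕ), m < n → ∀ (w : Fin m → ℂ), LinearIndependent ℚ w → (∀ i, w i ∈ Submodule.span ℚ (Set.range z)) →
      (m : Cardinal) ≤ Algebra.trdeg ℚ ↥(IntermediateField.adjoin ℚ (Set.range w ∪ Set.range (Complex.exp ∘ w)))) →
    (∀ w : ℂ, IsAlgebraic ↥(IntermediateField.adjoin ℚ (Set.range z ∪ Set.range (Complex.exp ∘ z))) w →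
      IsAlgebraic ↥(IntermediateField.adjoin ℚ (Set.range z ∪ Set.range (Complex.exp ∘ z))) (Complex.exp w) →
      w ∈ Submodule.span ℚ (Set.range z)) →
    (∀ (k : ℕ) (t : Fin k → ℂ) (β₀ γ₀ : Fin n → ℂ) (β γ : Fin n → Fin k → ℂ), (∀ i, IsAlgebraic ℚ (β₀ i)) →
      (∀ i j, IsAlgebraic ℚ (β i j)) → (∀ i, IsAlgebraic ℚ (γ₀ i)) → (∀ i j, IsAlgebraic ℚ (γ i j)) →
      (∀ i, z i = β₀ i + ∑ j, β i j * t j) → (∀ i, Complex.exp (z i) = γ₀ i + ∑ j, γ i j * t j) → n ≤ k) →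
    (∀ (k : ℕ) (t : Fin k → ℂ) (β₀ γ₀ : Fin n → ℂ) (β γ : Fin n → Fin k → ℂ) (δ ε : Fin n → Fin k → Fin k → ℂ),
      (∀ i, IsAlgebraic ℚ (β₀ i)) → (∀ i j, IsAlgebraic ℚ (β i j)) → (∀ i j j', IsAlgebraic ℚ (δ i j j')) →
      (∀ i, IsAlgebraic ℚ (γ₀ i)) → (∀ i j, IsAlgebraic ℚ (γ i j)) → (∀ i j j', IsAlgebraic ℚ (ε i j j')) →
      (∀ i, z i = β₀ i + ∑ j, β i j * t j + ∑ j, ∑ j', δ i j j' * (t j * t j')) →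
      (∀ i, Complex.exp (z i) = γ₀ i + ∑ j, γ i j * t j + ∑ j, ∑ j', ε i j j' * (t j * t j')) → n ≤ k) →
    (∀ (k : ℕ) (t : Fin k → ℂ) (D : MvPolynomial (Fin k) ℂ) (N E : Fin n → MvPolynomial (Fin k) ℂ),
      (∀ m, IsAlgebraic ℚ (MvPolynomial.coeff m D)) →
      (∀ i m, IsAlgebraic ℚ (MvPolynomial.coeff m (N i))) → (∀ i m, IsAlgebraic ℚ (MvPolynomial.coeff m (E i))) →
      MvPolynomial.eval t D ≠ 0 → (∀ i, z i * MvPolynomial.eval t D = MvPolynomial.eval t (N i)) →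
      (∀ i, Complex.exp (z i) * MvPolynomial.eval t D = MvPolynomial.eval t (E i)) → n ≤ k) →
    (Algebra.trdeg ℚ ↥(IntermediateField.adjoin ℚ (Set.range z ∪ Set.range (Complex.exp ∘ z))) <
      Algebra.trdeg ℚ ↥(IntermediateField.adjoin ℚ (Set.range z)) +
        Algebra.trdeg ℚ ↥(IntermediateField.adjoin ℚ (Set.range (Complex.exp ∘ z)))) →
      (∃ s : ℂ, Transcendental ℚ s ∧ IsAlgebraic ↥(adjoin ℚ (Set.range z)) s ∧ IsAlgebraic ↥(adjoin ℚ (Set.range (cexp ∘ z))) s)) := by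
  intro hP
  have hH := pillayHyp_expE_of_schanuel hS
  have hli := linearIndependent_pillayTuple hH
  exact not_modularWitness_pillayTuple hH (hP 3 le_rfl (pillayTuple (cexp (cexp 1))) hli (pillayTuple_mem_ecl expE_mem_ecl)
    (fun m _ w hw _ => hS m w hw) (saturated_pillayTuple_expE_of_schanuel hS) (affineNondegenerate_of_schanuel hS hli)
    (quadraticNondegenerate_of_schanuel hS hli) (rationalNondegenerate_of_schanuel hS hli) (entangled_pillayTuple hH))

/-- **Schanuel ⟹ an explicit SATURATED, entangled, witness-free ℚ-l.i. triple in `ecl ∅`** (the layer `Cᵉ[μ = 0]` of the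
residual is inhabited rel. S; the remaining binders of 30352 — span-minimality and the three non-degeneracies — hold at every
ℚ-l.i. tuple rel. S by `affineNondegenerate_of_schanuel` & co.). -/
theorem schanuel_forces_saturated_nonmodular_entanglement (hS : Literature.Periods.SchanuelConjecture) :
    ∃ z : Fin 3 → ℂ, (∀ i, z i ∈ Literature.NumberTheory.Transcendental.ecl (∅ : Set ℂ)) ∧ LinearIndependent ℚ z ∧
      (∀ w : ℂ, IsAlgebraic ↥(adjoin ℚ (Set.range z ∪ Set.range (cexp ∘ z))) w →
        IsAlgebraic ↥(adjoin ℚ (Set.range z ∪ Set.range (cexp ∘ z))) (cexp w) → w ∈ Submodule.span ℚ (Set.range z)) ∧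
      Algebra.trdeg ℚ ↥(adjoin ℚ (Set.range z ∪ Set.range (cexp ∘ z))) <
        Algebra.trdeg ℚ ↥(adjoin ℚ (Set.range z)) + Algebra.trdeg ℚ ↥(adjoin ℚ (Set.range (cexp ∘ z))) ∧
      ¬ (∃ s : ℂ, Transcendental ℚ s ∧ IsAlgebraic ↥(adjoin ℚ (Set.range z)) s ∧ IsAlgebraic ↥(adjoin ℚ (Set.range (cexp ∘ z))) s) :=
  ⟨pillayTuple (cexp (cexp 1)), pillayTuple_mem_ecl expE_mem_ecl, linearIndependent_pillayTuple (pillayHyp_expE_of_schanuel hS),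
    saturated_pillayTuple_expE_of_schanuel hS, entangled_pillayTuple (pillayHyp_expE_of_schanuel hS),
    not_modularWitness_pillayTuple (pillayHyp_expE_of_schanuel hS)⟩

end Summit.Schanuel.Schanuel.Theorems.RootDecomp1ModularLayer

end
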